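import Mathlib
import Literature.ModelTheory.ExponentialFields.ExponentialField

/-!
# Conjugation symmetrisation, part 1: the σ-normal form (helper for `AxisReduction`, stmt-Schanuel-24788)

A conjugation-stable finite-dimensional `ℚ`-subspace of `ℂ` is spanned by a `ℚ`-free AXIS tuple (every
coordinate real or purely imaginary). Port by the census seat of lens 6's
`HOME/decomp-schanuel-lens-6/ConjugationSymmetrisation.lean` (node «ConjugationCarving», critic-cleared
2026-08-30T01:40:14Z); used by `Theorems/RootDecomp1CAxisReduction.lean`. 0 sorry.
-/

set_option linter.dupNamespace false



namespace Summit.Schanuel.Schanuel.Theorems.RootDecomp1CAxisReduction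

open Complex
open scoped ComplexConjugate

/-! ## The σ-normal form: a conjugation-stable finite-dimensional ℚ-subspace of ℂ is spanned by an
axis tuple -/

/-- σ-normal form: if `span_ℚ(y)` is stable under complex conjugation, it contains a `ℚ`-linearly independent
AXIS tuple `w` (each `w i` real or purely imaginary) of length at least `dim_ℚ span_ℚ(y)`. -/
theorem exists_axis_tuple_of_conj_stable (ι : Type) [Fintype ι] (y : ι → ℂ)
    (hσ : ∀ j, conj (y j) ∈ Submodule.span ℚ (Set.range y)) :
    ∃ (p : ℕ) (w : Fin p → ℂ), (∀ i, (w i).im = 0 ∨ (w i).re = 0) ∧ LinearIndependent ℚ w ∧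
      (∀ i, w i ∈ Submodule.span ℚ (Set.range y)) ∧
      Module.finrank ℚ ↥(Submodule.span ℚ (Set.range y)) ≤ p := by
  classical
  set Y : Submodule ℚ ℂ := Submodule.span ℚ (Set.range y) with hY
  -- the ℚ-linear maps `r ↦ (r : ℂ)` and `v ↦ I * v`
  let ofRealQ : ℝ →ₗ[ℚ] ℂ :=
    Literature.ModelTheory.ExponentialFields.ExponentialRingHom.realComplex.toRingHom.toRatAlgHom.toLinearMap
  have ofRealQ_apply : ∀ r : ℝ, ofRealQ r = (r : ℂ) := fun r => rfl
  let mulI : ℂ →ₗ[ℚ] ℂ := LinearMap.mulLeft ℚ I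
  have mulI_apply : ∀ v : ℂ, mulI v = I * v := fun v => rfl
  -- real and imaginary parts, their ℚ-spans and bases
  set A : Submodule ℚ ℝ := Submodule.span ℚ (Set.range fun j => (y j).re) with hA
  set B : Submodule ℚ ℝ := Submodule.span ℚ (Set.range fun j => (y j).im) with hB
  haveI : FiniteDimensional ℚ A := FiniteDimensional.span_of_finite ℚ (Set.finite_range _)
  haveI : FiniteDimensional ℚ B := FiniteDimensional.span_of_finite ℚ (Set.finite_range _)
  set kA := Module.finrank ℚ A
  set kB := Module.finrank ℚ B
  let eA := Module.finBasis ℚ A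
  let eB := Module.finBasis ℚ B
  let rA : Fin kA → ℝ := fun i => (eA i : ℝ)
  let rB : Fin kB → ℝ := fun i => (eB i : ℝ)
  have hrAli : LinearIndependent ℚ rA := eA.linearIndependent.map' A.subtype A.ker_subtype
  have hrBli : LinearIndependent ℚ rB := eB.linearIndependent.map' B.subtype B.ker_subtype
  have hrA_span : Submodule.span ℚ (Set.range rA) = A := by
    have : Set.range rA = A.subtype '' Set.range eA := by
      rw [← Set.range_comp]; rfl
    rw [this, Submodule.span_image, eA.span_eq, Submodule.map_top, Submodule.range_subtype]
  have hrB_span : Submodule.span ℚ (Set.range rB) = B := by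
    have : Set.range rB = B.subtype '' Set.range eB := by
      rw [← Set.range_comp]; rfl
    rw [this, Submodule.span_image, eB.span_eq, Submodule.map_top, Submodule.range_subtype]
  let wA : Fin kA → ℂ := fun i => ((rA i : ℝ) : ℂ)
  let wB : Fin kB → ℂ := fun i => I * ((rB i : ℝ) : ℂ)
  have hwAli : LinearIndependent ℚ wA := by
    have := hrAli.map' ofRealQ (LinearMap.ker_eq_bot.mpr (by
      intro r s h; exact Complex.ofReal_injective h))
    exact this
  have hwBli : LinearIndependent ℚ wB := by
    have h1 : LinearIndependent ℚ (⇑ofRealQ ∘ rB) := hrBli.map' ofRealQ (LinearMap.ker_eq_bot.mpr (by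
      intro r s h; exact Complex.ofReal_injective h))
    have h2 := h1.map' mulI (LinearMap.ker_eq_bot.mpr (by
      intro u v h; exact mul_left_cancel₀ Complex.I_ne_zero h))
    exact h2
  -- every element of span wA is real, every element of span wB is purely imaginary
  have hspanA_im : ∀ v ∈ Submodule.span ℚ (Set.range wA), v.im = 0 := by
    intro v hv
    induction hv using Submodule.span_induction with
    | mem v hv => obtain ⟨i, rfl⟩ := hv; simp [wA]
    | zero => simp
    | add u v _ _ hu hv => simp [hu, hv]
    | smul q u _ hu => rw [Rat.smul_def, Complex.mul_im]; simp [hu]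
  have hspanB_re : ∀ v ∈ Submodule.span ℚ (Set.range wB), v.re = 0 := by
    intro v hv
    induction hv using Submodule.span_induction with
    | mem v hv => obtain ⟨i, rfl⟩ := hv; simp [wB]
    | zero => simp
    | add u v _ _ hu hv => simp [hu, hv]
    | smul q u _ hu => rw [Rat.smul_def, Complex.mul_re]; simp [hu]
  have hdisj : Disjoint (Submodule.span ℚ (Set.range wA)) (Submodule.span ℚ (Set.range wB)) := by
    rw [Submodule.disjoint_def]
    intro v hvA hvB
    apply Complex.ext
    · simpa using hspanB_re v hvB
    · simpa using hspanA_im v hvA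
  have hwli : LinearIndependent ℚ (Sum.elim wA wB) := hwAli.sum_type hwBli hdisj
  -- the axis tuple
  let w : Fin (kA + kB) → ℂ := fun i => Sum.elim wA wB (finSumFinEquiv.symm i)
  have hw_li : LinearIndependent ℚ w := hwli.comp _ finSumFinEquiv.symm.injective
  -- generators of `Y` decompose along `A` and `B`
  have hre_mem : ∀ r ∈ A, ((r : ℝ) : ℂ) ∈ Y := by
    intro r hr
    induction hr using Submodule.span_induction with
    | mem r hr =>
      obtain ⟨j, rfl⟩ := hr
      have hid : ((((y j).re : ℝ)) : ℂ) = ((1 / 2 : ℚ) : ℂ) * (y j + conj (y j)) := by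
        apply Complex.ext
        · simp; ring
        · simp
      rw [hid, ← Rat.smul_def]
      exact Y.smul_mem _ (Y.add_mem (Submodule.subset_span ⟨j, rfl⟩) (hσ j))
    | zero => simp
    | add r s _ _ hr hs => rw [Complex.ofReal_add]; exact Y.add_mem hr hs
    | smul q r _ hr =>
      rw [Rat.smul_def, Complex.ofReal_mul, Complex.ofReal_ratCast, ← Rat.smul_def]
      exact Y.smul_mem q hr
  have him_mem : ∀ r ∈ B, I * ((r : ℝ) : ℂ) ∈ Y := by
    intro r hr
    induction hr using Submodule.span_induction with
    | mem r hr =>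
      obtain ⟨j, rfl⟩ := hr
      have hid : I * ((((y j).im : ℝ)) : ℂ) = ((1 / 2 : ℚ) : ℂ) * (y j - conj (y j)) := by
        apply Complex.ext
        · simp
        · simp; ring
      rw [hid, ← Rat.smul_def]
      exact Y.smul_mem _ (Y.sub_mem (Submodule.subset_span ⟨j, rfl⟩) (hσ j))
    | zero => simp
    | add r s _ _ hr hs => rw [Complex.ofReal_add, mul_add]; exact Y.add_mem hr hs
    | smul q r _ hr =>
      rw [Rat.smul_def, Complex.ofReal_mul, Complex.ofReal_ratCast, mul_left_comm, ← Rat.smul_def]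
      exact Y.smul_mem q hr
  -- the axis property, membership in `Y`, and the dimension count
  have hw_axis : ∀ i, (w i).im = 0 ∨ (w i).re = 0 := by
    intro i
    induction i using Fin.addCases with
    | left a => exact Or.inl (by simp [w, wA, finSumFinEquiv_symm_apply_castAdd])
    | right b => exact Or.inr (by simp [w, wB, finSumFinEquiv_symm_apply_natAdd])
  have hw_mem : ∀ i, w i ∈ Y := by
    intro i
    induction i using Fin.addCases with
    | left a =>
      simp only [w, finSumFinEquiv_symm_apply_castAdd, Sum.elim_inl]
      exact hre_mem _ (eA a).2
    | right b =>
      simp only [w, finSumFinEquiv_symm_apply_natAdd, Sum.elim_inr]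
      exact him_mem _ (eB b).2
  haveI : FiniteDimensional ℚ ↥(Submodule.span ℚ (Set.range w)) :=
    FiniteDimensional.span_of_finite ℚ (Set.finite_range w)
  have hY_le : Y ≤ Submodule.span ℚ (Set.range w) := by
    rw [hY, Submodule.span_le]
    rintro _ ⟨j, rfl⟩
    have hdecomp : y j = (((y j).re : ℝ) : ℂ) + I * (((y j).im : ℝ) : ℂ) := by
      rw [mul_comm]; exact (Complex.re_add_im (y j)).symm
    rw [hdecomp]
    refine Submodule.add_mem _ ?_ ?_
    · have h1 : (y j).re ∈ Submodule.span ℚ (Set.range rA) := by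
        rw [hrA_span]; exact Submodule.subset_span ⟨j, rfl⟩
      have h2 := Submodule.mem_map_of_mem (f := ofRealQ) h1
      rw [Submodule.map_span, ← Set.range_comp] at h2
      refine Submodule.span_mono ?_ h2
      rintro _ ⟨a, rfl⟩
      exact ⟨Fin.castAdd kB a, by simp [w, wA, finSumFinEquiv_symm_apply_castAdd, ofRealQ_apply]⟩
    · have h1 : (y j).im ∈ Submodule.span ℚ (Set.range rB) := by
        rw [hrB_span]; exact Submodule.subset_span ⟨j, rfl⟩
      have h2 := Submodule.mem_map_of_mem (f := mulI.comp ofRealQ) h1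
      rw [Submodule.map_span, ← Set.range_comp] at h2
      refine Submodule.span_mono ?_ h2
      rintro _ ⟨b, rfl⟩
      exact ⟨Fin.natAdd kA b, by
        simp [w, wB, finSumFinEquiv_symm_apply_natAdd, ofRealQ_apply, mulI_apply]⟩
  have hfin : Module.finrank ℚ Y ≤ kA + kB := by
    calc Module.finrank ℚ Y ≤ Module.finrank ℚ ↥(Submodule.span ℚ (Set.range w)) :=
          Submodule.finrank_mono hY_le
      _ ≤ Fintype.card (Fin (kA + kB)) := finrank_range_le_card w
      _ = kA + kB := Fintype.card_fin _
  exact ⟨kA + kB, w, hw_axis, hw_li, hw_mem, hfin⟩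

end Summit.Schanuel.Schanuel.Theorems.RootDecomp1CAxisReduction
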